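import Summits.Ventures.HodgeRepro2.T6N43HostFockRec

/-!
# T6N43TwistRead — the twist reading of the RS-N4.3 lane, READ FROM PRINT: `r_j = −m′_j`, the archimedean
L-factors it forces, and the host bundle on which the three Eischen–Liu displays are THEOREMS

FILED by seat t6-p6 (gen 19, wave 1; staged gen 17 as continuation-readiness of the RS-N4.3
lane, step 4; owner file route/T6-N43-t6-p6.md §21). T6N43HostFockRec (gen 16; filed in WAVE 1, p438312)
left ONE print
item open in the lane: the twist `r_j` of the display `Hyp.EischenLiu2024_Sec2_2` on the host bundle
(`hostFockRecPlus` / `hostFockRecMinus`, both evaluated, none asserted). This file records the seat's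
FIRST-HAND reading of the three printed conventions that decide it (an OFFER for t6-lit's page-card;
the decision at install is the lead's) and its consequences in kernel:

* [KK07] Konno–Konno, Kyushu J. Math. 61 (2007), p. 49 (layer paper:doi-10-2206-kyushujm-61-35 p0015
  ll. 21–28; C67 (B4)): ‹The character pair ξ = (ξ, ξ′) can be written as ξ(z) = (z/z̄)^{m/2}, ξ′(z) =
  (z/z̄)^{m′/2}, m ≡ n′, m′ ≡ n (mod 2) ∈ ℤ›, with p. 36 (p0002 ll. 5–6; C67 (B1)) ‹ξ|_{ℝ^×} = sgn^{dim_ℂ W},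
  ξ′|_{ℝ^×} = sgn^{dim_ℂ V}› and p. 48 (p0014 l. 6, the convention sentence ll. 5–8; C67 (B3))
  ‹ω_{V,ξ′} = ξ′_u(det)› when W = 0 — ξ′ is the character of
  the `U(W)`-side splitting (restriction sgn^{dim V}), the record's ξ′ («the U(W₁₂)-side splitting
  character of the doubled pair (W₁₂, V) (restriction η^{dim V} = η; weights m′_j ODD)», MEMO-route-2
  §10.3 l. 913) and GQT's χ_V (‹a Hecke character of 𝔸_E^× such that χ_V|_{𝔸^×} = χ_E^m›, §11.2, layer
  paper:arxiv-1207.4709 p0033 ll. 56–57; C67 (D1); the doubling factor is ‹L(s, π_v × χ_{V,v})›, §11.6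
  p0034 ll. 74–75; C67 (D2)). The odd half-integral power `(z/z̄)^{m′/2}` is the character `(z/|z|)^{m′}` — a square root
  of `(z/z̄)^{m′}` in kernel (`splitCharKK_sq`), and the only continuous one with value `1` at `z = 1`
  (`ℂ^×` connected — a remark, not in kernel); Liu 2021 prints the same
  character as ‹μ_m(z) = arg(z)^m, m odd integer› (Cambridge J. Math. 9 (2021), p. 127, layer
  paper:liu2021-fourier-jacobi-cycles-arithmetic-relative-trace-formula p0127 l. 21; C67 (C4)) with
  ‹arg(z) := z/√(z z̄)› (p. 6, layer p0006 ll. 6–7; C67 (C1)), the dictionary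
  Liu's m = [KK07]'s m being the record's (MEMO §10.2).
* Eischen–Liu §2.2 (the display's own quote, QA-t6lit-17 EXACT; layer p0008 ll. 8–9, C67 (A4)): ‹Let χ_ac
  be the unitary character of ℂ^× which takes the value x/(x x̄)^{1/2} at x ∈ ℂ, and r be an integer. The
  local L-factor for 𝒟^*_{(τ;ν)} × χ^r_ac is …› — `χ_ac = arg`, so the record's `χ_{V,τ′_j}|_{ℂ^×} = ξ′_{τ′_j} =
  (z/z̄)^{m′_j/2} = χ_ac^{m′_j}` (`splitCharKK_mPrime`): in the docstring's dictionary
  «χ_{V,τ′}|_{ℂ^×} = χ_ac^r» the raw twist is `+m′_j`.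
* The display is printed for the CONTRAGREDIENT `𝒟^*_{(τ;ν)} × χ_ac^r`, the route's `π₀,τ′_j` is the
  holomorphic `𝒟_{(τ;ν)}` (T6N43Weights: `(τ; ν) = ((n_j+3); (n_j))`, `((n₁,n₁); ())`), and
  `L(s, 𝒟 × χ_ac^{m′}) = L(s, (𝒟 × χ_ac^{m′})^∨) = L(s, 𝒟^* × χ_ac^{−m′})` (the display docstring's
  «amounts to r ↦ −r»; `L(s, ρ^∨) = L(s, ρ)` because every summand of these parameters is a unitary
  character of ℂ^× and `Γ_ℂ(s + |k|/2)` is even in `k`). Hence the display's argument is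
  `r_j = −m′_j = twistRead n_j` — the `hostFockRecMinus` reading; the forced values are
  `L_{τ′₁}(s) = Γ_ℂ(s + |2n₁+2|) Γ_ℂ(s + |2n₁+1|)` and `L_{τ′_j}(s) = Γ_ℂ(s + |2n_j+4|) Γ_ℂ(s + |2n_j+2|)`
  (`elLfacTau1`, `elLfacTauj`; cross-check by the standard base change: `det^{n}` of `U(2)` has
  parameter `(z/z̄)^{n+1/2} ⊕ (z/z̄)^{n−1/2}`, twisted by `(z/z̄)^{n+3/2}` it is `(z/z̄)^{2n+2} ⊕
  (z/z̄)^{2n+1}`; the lowest-weight-3 module at τ′_j has Harish-Chandra parameter `(n+5/2; n+1/2)`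
  (E–L (2.2.1)), twisted: `2n+4`, `2n+2`).

What is in kernel: the characters `chiAc` (= E–L's χ_ac = Liu's arg) and `splitCharKK m` (= [KK07]'s
`(z/z̄)^{m/2}` = Liu's `μ_m`) with their printed properties (character, unitary, square `(z/z̄)^m`,
restriction to `ℝ^×` = `sgn^m` — the printed condition `ξ′|_{ℝ^×} = sgn^{dim V}` for odd `m′` and
`dim V = 3`); the reading `twistRead n = −m′`; the display EVALUATED on the reading (`eischenLiu_tau1_read`,
`eischenLiu_tauj_read`: the display HOLDS, as a theorem, on the values `elLfacTau1` / `elLfacTauj`);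
the bundles `hostFockRecRead` (= `hostFockRecMinus`) and **`hostFockRecEL n₁ n₂ n₃`** (THREE explicit
arguments = the datum's own odd weights through `n_j = (m′_j − 3)/2`; the L-factors set to the forced
values), on which the three Eischen–Liu displays are THEOREMS (`hostFockRecEL_EL₁/₂/₃`) and THEOREM
N4.3 follows from the TWO Rühl displays alone (`hostFockRecEL_N43_places`,
`hostFockRecEL_archNonvanishing`); `lvArchRead n₁ n₂ n₃ : Fin 3 → ℂ → ℂ` = the values the host
inhabitant's `d41.Lv (Sum.inr j)` must take for the M2 binders `hEL_jA/B` to be discharged on it.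
Nothing here is a toy transfer to the host datum `M` (the lead's open binder); no display is declared;
nothing of Tiers 3–5 is re-opened; the reading is NOT a decision of the cell (install decision (2) of the
draft seat map). Axioms: {propext, Classical.choice, Quot.sound}.

§8(d): uses an L-value-free non-vanishing device: NO.

Filed in Tier-6 WAVE 1 as p438565 (ACCEPTED 2026-08-26T10:38:08Z, commit
a9c5361bae04bd8b639937dc39a1610161a5d6cc); this v2 differs from the filed bytes in this module docstring only — the
«(staged)» tags on sibling files, all filed in WAVE 1, replaced by their filing references (the PARK release
clause, STATUS l. 12943 / l. 13037 (1)); every declaration byte-identical.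
-/

namespace Summit.Ventures.HodgeRepro2.T6

open N43Weights

namespace N43Twist

/-- Eischen–Liu's `χ_ac`, ‹the unitary character of ℂ^× which takes the value x/(x x̄)^{1/2} at x ∈ ℂ›
(§2.2) = Liu 2021's ‹argument character … arg(z) := z/√(z z̄)› (p. 6): the unit-modulus part
`z / ‖z‖` of `z` (`(z z̄)^{1/2} = ‖z‖`; the value at `0` is `0`, irrelevant for a character of `ℂ^×`). -/
noncomputable def chiAc (z : ℂ) : ℂ := z / (‖z‖ : ℂ)

/-- `(z z̄)^{1/2} = ‖z‖`: the printed denominator is the norm (`Complex.norm_def`, `Complex.mul_conj`). -/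
theorem chiAc_eq_div_sqrt (z : ℂ) :
    chiAc z = z / ((Real.sqrt (Complex.normSq z) : ℝ) : ℂ) := by
  unfold chiAc
  rw [Complex.norm_def]

/-- `χ_ac` is unitary on `ℂ^×`. -/
theorem chiAc_norm {z : ℂ} (hz : z ≠ 0) : ‖chiAc z‖ = 1 := by
  unfold chiAc
  rw [norm_div, Complex.norm_real, Real.norm_of_nonneg (norm_nonneg z),
    div_self (norm_ne_zero_iff.mpr hz)]

/-- `χ_ac` is multiplicative. -/
theorem chiAc_mul (z w : ℂ) : chiAc (z * w) = chiAc z * chiAc w := by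
  unfold chiAc
  rw [norm_mul, Complex.ofReal_mul]
  ring

/-- `χ_ac(1) = 1`. -/
theorem chiAc_one : chiAc 1 = 1 := by
  simp [chiAc]

/-- `χ_ac(z̄) = χ_ac(z)⁻¹` on `ℂ^×` (the conjugate embedding inverts the character: the orientation
of `ℂ^× = E_{τ′}^×` is the one of the embedding `τ′` fixed by the record). -/
theorem chiAc_conj {z : ℂ} (hz : z ≠ 0) : chiAc ((starRingEnd ℂ) z) = (chiAc z)⁻¹ := by
  unfold chiAc
  have hn : ((‖z‖ : ℝ) : ℂ) ≠ 0 := by exact_mod_cast norm_ne_zero_iff.mpr hz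
  rw [Complex.norm_conj, inv_div, div_eq_div_iff hn hz, mul_comm, Complex.mul_conj', sq]

/-- `χ_ac` on a positive real is `1`. -/
theorem chiAc_ofReal_of_pos {x : ℝ} (hx : 0 < x) : chiAc (x : ℂ) = 1 := by
  unfold chiAc
  rw [Complex.norm_real, Real.norm_of_nonneg hx.le]
  exact div_self (Complex.ofReal_ne_zero.mpr hx.ne')

/-- `χ_ac` on a negative real is `−1`: `χ_ac|_{ℝ^×} = sgn`. -/
theorem chiAc_ofReal_of_neg {x : ℝ} (hx : x < 0) : chiAc (x : ℂ) = -1 := by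
  unfold chiAc
  rw [Complex.norm_real, Real.norm_of_nonpos hx.le, Complex.ofReal_neg, div_neg,
    div_self (Complex.ofReal_ne_zero.mpr hx.ne)]

/-- `χ_ac(z)² = z/z̄` on `ℂ^×`: the printed `(z/z̄)^{1/2}` of [KK07] / HKS is `χ_ac`. -/
theorem chiAc_sq {z : ℂ} (hz : z ≠ 0) : chiAc z ^ 2 = z / (starRingEnd ℂ) z := by
  unfold chiAc
  have hn : ((‖z‖ : ℝ) : ℂ) ≠ 0 := by exact_mod_cast norm_ne_zero_iff.mpr hz
  have hc : (starRingEnd ℂ) z ≠ 0 := (map_ne_zero _).mpr hz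
  rw [div_pow, div_eq_div_iff (pow_ne_zero 2 hn) hc, ← Complex.mul_conj']
  ring

/-- [KK07] p. 49 ‹ξ′(z) = (z/z̄)^{m′/2}› = Liu 2021 p. 127 ‹μ_m(z) = arg(z)^m›: the character
`z ↦ χ_ac(z)^m` of `ℂ^×` — the splitting character of weight `m` in the record's convention. -/
noncomputable def splitCharKK (m : ℤ) (z : ℂ) : ℂ := chiAc z ^ m

/-- The printed half-integral power: `ξ′(z)² = (z/z̄)^{m′}` on `ℂ^×` (`splitCharKK m` is a square root of
`(z/z̄)^m`; it is the continuous one with `ξ′(1) = 1`, i.e. the character). -/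
theorem splitCharKK_sq (m : ℤ) {z : ℂ} (hz : z ≠ 0) :
    splitCharKK m z ^ 2 = (z / (starRingEnd ℂ) z) ^ m := by
  unfold splitCharKK
  rw [← zpow_natCast, ← zpow_mul, mul_comm, zpow_mul, zpow_natCast, chiAc_sq hz]

/-- `ξ′` is multiplicative. -/
theorem splitCharKK_mul (m : ℤ) (z w : ℂ) :
    splitCharKK m (z * w) = splitCharKK m z * splitCharKK m w := by
  unfold splitCharKK
  rw [chiAc_mul, mul_zpow]

/-- `ξ′(1) = 1`. -/
theorem splitCharKK_one (m : ℤ) : splitCharKK m 1 = 1 := by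
  simp [splitCharKK, chiAc_one]

/-- `ξ′` is unitary on `ℂ^×`. -/
theorem splitCharKK_norm (m : ℤ) {z : ℂ} (hz : z ≠ 0) : ‖splitCharKK m z‖ = 1 := by
  unfold splitCharKK
  rw [norm_zpow, chiAc_norm hz, one_zpow]

/-- `ξ′` on a positive real is `1`. -/
theorem splitCharKK_ofReal_of_pos (m : ℤ) {x : ℝ} (hx : 0 < x) : splitCharKK m (x : ℂ) = 1 := by
  unfold splitCharKK
  rw [chiAc_ofReal_of_pos hx, one_zpow]

/-- For ODD `m`, `ξ′` on a negative real is `−1`: `ξ′|_{ℝ^×} = sgn` — the printed condition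
‹ξ′|_{ℝ^×} = sgn^{dim_ℂ V}› ([KK07] p. 36) for `dim V = 3` with the record's odd `m′` (`odd_mPrime`). -/
theorem splitCharKK_ofReal_of_neg_of_odd {m : ℤ} (hm : Odd m) {x : ℝ} (hx : x < 0) :
    splitCharKK m (x : ℂ) = -1 := by
  unfold splitCharKK
  rw [chiAc_ofReal_of_neg hx, hm.neg_one_zpow]

/-- The restriction of the record's splitting character (weight `m′ = 2n + 3`) to `ℝ^×` is `sgn`
(`[KK07]`'s ‹ξ′|_{ℝ^×} = sgn^{dim_ℂ V}›, `dim V = 3`). -/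
theorem splitCharKK_mPrime_ofReal_of_neg (n : ℤ) {x : ℝ} (hx : x < 0) :
    splitCharKK (mPrime n) (x : ℂ) = -1 :=
  splitCharKK_ofReal_of_neg_of_odd (odd_mPrime n) hx

/-- THE TWIST READING: the display's `r_j` for the record's weight `m′_j = 2 n_j + 3` is `−m′_j`
(the raw twist `χ_{V,τ′_j}|_{ℂ^×} = χ_ac^{+m′_j}` of `splitCharKK_mPrime`, then the printed
contragredient `𝒟^* × χ_ac^r` against the route's holomorphic `π₀` — the display docstring's
«amounts to r ↦ −r»). An OFFER for the install decision, not a ruling of the cell. -/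
def twistRead (n : ℤ) : ℤ := -mPrime n

/-- `twistRead n = −(2n + 3)`. -/
theorem twistRead_eq (n : ℤ) : twistRead n = -(2 * n + 3) := rfl

/-- The record's splitting character at the place is `χ_ac^{m′}` = `χ_ac^{−r}` for the read twist
`r = twistRead n`: in the display docstring's dictionary «χ_{V,τ′}|_{ℂ^×} = χ_ac^r» the raw exponent
is `+m′`; the sign of the display's argument comes from the contragredient alone. -/
theorem splitCharKK_mPrime (n : ℤ) (z : ℂ) :
    splitCharKK (mPrime n) z = chiAc z ^ (-twistRead n) := by
  simp [splitCharKK, twistRead]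

end N43Twist

open N43Twist

namespace N43Host

/-- The archimedean L-factor at τ′₁ forced by the reading: `L(s) = Γ_ℂ(s + |2n₁+2|) · Γ_ℂ(s + |2n₁+1|)`
(the display at `(2,0)`, `τ = (n₁, n₁)`, `r = −m′₁`). -/
noncomputable def elLfacTau1 (n : ℤ) (s : ℂ) : ℂ :=
  T5GammaFactor.GammaC (s + ((|2 * (n : ℝ) + 2| : ℝ) : ℂ)) *
    T5GammaFactor.GammaC (s + ((|2 * (n : ℝ) + 1| : ℝ) : ℂ))

/-- The archimedean L-factor at τ′_j forced by the reading: `L(s) = Γ_ℂ(s + |2n_j+4|) · Γ_ℂ(s + |2n_j+2|)`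
(the display at `(1,1)`, `(τ; ν) = ((n_j+3); (n_j))`, `r = −m′_j`). -/
noncomputable def elLfacTauj (n : ℤ) (s : ℂ) : ℂ :=
  T5GammaFactor.GammaC (s + ((|2 * (n : ℝ) + 4| : ℝ) : ℂ)) *
    T5GammaFactor.GammaC (s + ((|2 * (n : ℝ) + 2| : ℝ) : ℂ))

/-- THE DISPLAY HOLDS on the reading at τ′₁: `Hyp.EischenLiu2024_Sec2_2 2 0 (n₁,n₁) () (−m′₁) L` for
`L = elLfacTau1 n₁` (a theorem, not a hypothesis). -/
theorem eischenLiu_tau1_read (n : ℤ) :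
    Hyp.EischenLiu2024_Sec2_2 2 0 (tauRec₁ n) nuRec₁ (twistRead n) (elLfacTau1 n) :=
  (eischenLiu_tau1_twistMinus n (elLfacTau1 n)).mpr (fun _ => rfl)

/-- THE DISPLAY HOLDS on the reading at τ′_j: `Hyp.EischenLiu2024_Sec2_2 1 1 (n+3) (n) (−m′) L` for
`L = elLfacTauj n`. -/
theorem eischenLiu_tauj_read (n : ℤ) :
    Hyp.EischenLiu2024_Sec2_2 1 1 (tauRec n) (nuRec n) (twistRead n) (elLfacTauj n) :=
  (eischenLiu_tauj_twistMinus n (elLfacTauj n)).mpr (fun _ => rfl)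

/-- `L_{τ′₁}(1) ≠ 0` on the reading (all THEOREM N4.3 consumes of the factor). -/
theorem elLfacTau1_one_ne_zero (n : ℤ) : elLfacTau1 n 1 ≠ 0 :=
  lfac_one_ne_zero_tau1 n (twistRead n) (elLfacTau1 n) (eischenLiu_tau1_read n)

/-- `L_{τ′_j}(1) ≠ 0` on the reading. -/
theorem elLfacTauj_one_ne_zero (n : ℤ) : elLfacTauj n 1 ≠ 0 :=
  lfac_one_ne_zero_tauj n (twistRead n) (elLfacTauj n) (eischenLiu_tauj_read n)

/-- For `n ≥ 0` (weights `m′ ≥ 3`) the absolute values drop: `L_{τ′₁}(s) = Γ_ℂ(s + 2n + 2) Γ_ℂ(s + 2n + 1)`. -/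
theorem elLfacTau1_of_nonneg {n : ℤ} (hn : 0 ≤ n) (s : ℂ) :
    elLfacTau1 n s =
      T5GammaFactor.GammaC (s + (2 * (n : ℂ) + 2)) * T5GammaFactor.GammaC (s + (2 * (n : ℂ) + 1)) := by
  have hn' : (0 : ℝ) ≤ (n : ℝ) := by exact_mod_cast hn
  have h₁ : (|2 * (n : ℝ) + 2| : ℝ) = 2 * (n : ℝ) + 2 := abs_of_nonneg (by linarith)
  have h₂ : (|2 * (n : ℝ) + 1| : ℝ) = 2 * (n : ℝ) + 1 := abs_of_nonneg (by linarith)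
  unfold elLfacTau1
  simp only [h₁, h₂, Complex.ofReal_add, Complex.ofReal_mul, Complex.ofReal_intCast,
    Complex.ofReal_ofNat, Complex.ofReal_one]

/-- For `n ≥ 0` the absolute values drop: `L_{τ′_j}(s) = Γ_ℂ(s + 2n + 4) Γ_ℂ(s + 2n + 2)`. -/
theorem elLfacTauj_of_nonneg {n : ℤ} (hn : 0 ≤ n) (s : ℂ) :
    elLfacTauj n s =
      T5GammaFactor.GammaC (s + (2 * (n : ℂ) + 4)) * T5GammaFactor.GammaC (s + (2 * (n : ℂ) + 2)) := by
  have hn' : (0 : ℝ) ≤ (n : ℝ) := by exact_mod_cast hn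
  have h₁ : (|2 * (n : ℝ) + 4| : ℝ) = 2 * (n : ℝ) + 4 := abs_of_nonneg (by linarith)
  have h₂ : (|2 * (n : ℝ) + 2| : ℝ) = 2 * (n : ℝ) + 2 := abs_of_nonneg (by linarith)
  unfold elLfacTauj
  simp only [h₁, h₂, Complex.ofReal_add, Complex.ofReal_mul, Complex.ofReal_intCast,
    Complex.ofReal_ofNat]

/-- The minimal weight `m′ = 3` (`n = 0`): `L_{τ′₁}(s) = Γ_ℂ(s + 2) Γ_ℂ(s + 1)`. -/
theorem elLfacTau1_zero (s : ℂ) :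
    elLfacTau1 0 s = T5GammaFactor.GammaC (s + 2) * T5GammaFactor.GammaC (s + 1) := by
  rw [elLfacTau1_of_nonneg le_rfl]
  simp

/-- The minimal weight `m′ = 3` (`n = 0`): `L_{τ′_j}(s) = Γ_ℂ(s + 4) Γ_ℂ(s + 2)`. -/
theorem elLfacTauj_zero (s : ℂ) :
    elLfacTauj 0 s = T5GammaFactor.GammaC (s + 4) * T5GammaFactor.GammaC (s + 2) := by
  rw [elLfacTauj_of_nonneg le_rfl]
  simp

/-- The host bundle on the READ twist (`r_j = twistRead n_j = −m′_j`), the L-factors still explicit. -/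
noncomputable def BergmanPlaces.hostFockRecRead (n₁ n₂ n₃ : ℤ) (L₁ L₂ L₃ : ℂ → ℂ) :
    N43Places.BergmanPlaces :=
  BergmanPlaces.hostFockRec n₁ n₂ n₃ (twistRead n₁) (twistRead n₂) (twistRead n₃) L₁ L₂ L₃

/-- The read bundle IS the `−` reading of T6N43HostFockRec (definitional record). -/
theorem BergmanPlaces.hostFockRecRead_eq_minus (n₁ n₂ n₃ : ℤ) (L₁ L₂ L₃ : ℂ → ℂ) :
    BergmanPlaces.hostFockRecRead n₁ n₂ n₃ L₁ L₂ L₃ = BergmanPlaces.hostFockRecMinus n₁ n₂ n₃ L₁ L₂ L₃ :=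
  rfl

/-- THE LANE'S CANDIDATE `d43` TERM ON THE READING: the host bundle with the L-factors set to the values
the three Eischen–Liu displays force — THREE explicit arguments, the datum's own odd weights
`m′_j = 2 n_j + 3` through `n_j` (DATA of `D`, MEMO §10.3); no free choice of the lane left. -/
noncomputable def BergmanPlaces.hostFockRecEL (n₁ n₂ n₃ : ℤ) : N43Places.BergmanPlaces :=
  BergmanPlaces.hostFockRecRead n₁ n₂ n₃ (elLfacTau1 n₁) (elLfacTauj n₂) (elLfacTauj n₃)

/-- The parameters of the bundle (definitional record): the record's weights, the read twists, the
forced L-factors. -/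
theorem BergmanPlaces.hostFockRecEL_params (n₁ n₂ n₃ : ℤ) :
    (BergmanPlaces.hostFockRecEL n₁ n₂ n₃).toPlaces.m = n₁ ∧
    (BergmanPlaces.hostFockRecEL n₁ n₂ n₃).toPlaces.τ₁ = tauRec₁ n₁ ∧
    (BergmanPlaces.hostFockRecEL n₁ n₂ n₃).toPlaces.ν₁ = nuRec₁ ∧
    (BergmanPlaces.hostFockRecEL n₁ n₂ n₃).toPlaces.r₁ = twistRead n₁ ∧
    (BergmanPlaces.hostFockRecEL n₁ n₂ n₃).toPlaces.d₁.Lfac = elLfacTau1 n₁ ∧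
    (BergmanPlaces.hostFockRecEL n₁ n₂ n₃).toPlaces.τ₂ = tauRec n₂ ∧
    (BergmanPlaces.hostFockRecEL n₁ n₂ n₃).toPlaces.ν₂ = nuRec n₂ ∧
    (BergmanPlaces.hostFockRecEL n₁ n₂ n₃).toPlaces.r₂ = twistRead n₂ ∧
    (BergmanPlaces.hostFockRecEL n₁ n₂ n₃).toPlaces.d₂.Lfac = elLfacTauj n₂ ∧
    (BergmanPlaces.hostFockRecEL n₁ n₂ n₃).toPlaces.τ₃ = tauRec n₃ ∧
    (BergmanPlaces.hostFockRecEL n₁ n₂ n₃).toPlaces.ν₃ = nuRec n₃ ∧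
    (BergmanPlaces.hostFockRecEL n₁ n₂ n₃).toPlaces.r₃ = twistRead n₃ ∧
    (BergmanPlaces.hostFockRecEL n₁ n₂ n₃).toPlaces.d₃.Lfac = elLfacTauj n₃ :=
  ⟨rfl, rfl, rfl, rfl, rfl, rfl, rfl, rfl, rfl, rfl, rfl, rfl, rfl⟩

/-- The carriers and measures of the bundle are the real ones (definitional record): `H₁ = U(2)`,
`H₂ = H₃ = U(1,1)`, `μ₁ = haarU2`, `μ₂ = μ₃ = haarU11`. -/
theorem BergmanPlaces.hostFockRecEL_carriers (n₁ n₂ n₃ : ℤ) :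
    (BergmanPlaces.hostFockRecEL n₁ n₂ n₃).toPlaces.H₁ = U2 ∧
    (BergmanPlaces.hostFockRecEL n₁ n₂ n₃).toPlaces.H₂ = U11 ∧
    (BergmanPlaces.hostFockRecEL n₁ n₂ n₃).toPlaces.H₃ = U11 ∧
    (BergmanPlaces.hostFockRecEL n₁ n₂ n₃).toPlaces.d₁.μ = haarU2 ∧
    (BergmanPlaces.hostFockRecEL n₁ n₂ n₃).toPlaces.d₂.μ = haarU11 ∧
    (BergmanPlaces.hostFockRecEL n₁ n₂ n₃).toPlaces.d₃.μ = haarU11 :=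
  ⟨rfl, rfl, rfl, rfl, rfl, rfl⟩

/-- THE EISCHEN–LIU DISPLAY AT τ′₁ IS A THEOREM on the bundle, in the shape the M2 statement consumes
(`hEL₁A : Hyp.EischenLiu2024_Sec2_2 2 0 d43.τ₁ d43.ν₁ d43.r₁ (d41.Lv (Sum.inr 0))` with
`d43 = (hostFockRecEL …).toPlaces` and `d41.Lv (Sum.inr 0) = elLfacTau1 n₁`). -/
theorem hostFockRecEL_EL₁ (n₁ n₂ n₃ : ℤ) :
    Hyp.EischenLiu2024_Sec2_2 2 0
      (BergmanPlaces.hostFockRecEL n₁ n₂ n₃).toPlaces.τ₁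
      (BergmanPlaces.hostFockRecEL n₁ n₂ n₃).toPlaces.ν₁
      (BergmanPlaces.hostFockRecEL n₁ n₂ n₃).toPlaces.r₁ (elLfacTau1 n₁) :=
  eischenLiu_tau1_read n₁

/-- THE EISCHEN–LIU DISPLAY AT τ′₂ IS A THEOREM on the bundle. -/
theorem hostFockRecEL_EL₂ (n₁ n₂ n₃ : ℤ) :
    Hyp.EischenLiu2024_Sec2_2 1 1
      (BergmanPlaces.hostFockRecEL n₁ n₂ n₃).toPlaces.τ₂
      (BergmanPlaces.hostFockRecEL n₁ n₂ n₃).toPlaces.ν₂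
      (BergmanPlaces.hostFockRecEL n₁ n₂ n₃).toPlaces.r₂ (elLfacTauj n₂) :=
  eischenLiu_tauj_read n₂

/-- THE EISCHEN–LIU DISPLAY AT τ′₃ IS A THEOREM on the bundle. -/
theorem hostFockRecEL_EL₃ (n₁ n₂ n₃ : ℤ) :
    Hyp.EischenLiu2024_Sec2_2 1 1
      (BergmanPlaces.hostFockRecEL n₁ n₂ n₃).toPlaces.τ₃
      (BergmanPlaces.hostFockRecEL n₁ n₂ n₃).toPlaces.ν₃
      (BergmanPlaces.hostFockRecEL n₁ n₂ n₃).toPlaces.r₃ (elLfacTauj n₃) :=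
  eischenLiu_tauj_read n₃

/-- THEOREM N4.3 (a)–(c) on the bundle FROM THE TWO RÜHL DISPLAYS ALONE (the three Eischen–Liu
displays are theorems here): `Re Z_{τ′_j}(1/2) > 0` and `Z^*_{τ′_j}(1/2) ≠ 0` at the three places. -/
theorem hostFockRecEL_N43_places (n₁ n₂ n₃ : ℤ)
    (hA2f₂ : Hyp.Ruhl1970_A2f (BergmanPlaces.hostFockRecEL n₁ n₂ n₃).toPlaces.d₂)
    (hA2f₃ : Hyp.Ruhl1970_A2f (BergmanPlaces.hostFockRecEL n₁ n₂ n₃).toPlaces.d₃) :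
    (∀ j : Fin 3, 0 < ((BergmanPlaces.hostFockRecEL n₁ n₂ n₃).toPlaces.zetaAt j).re) ∧
      (BergmanPlaces.hostFockRecEL n₁ n₂ n₃).toPlaces.ArchNonvanishing :=
  (BergmanPlaces.hostFockRecEL n₁ n₂ n₃).N43_places_bergman (eischenLiu_tau1_read n₁) hA2f₂
    (eischenLiu_tauj_read n₂) hA2f₃ (eischenLiu_tauj_read n₃)

/-- THEOREM N4.3 (c) on the bundle from the two Rühl displays alone (the conjunct the M2 carrier's
`iA` / `iB` read). -/
theorem hostFockRecEL_archNonvanishing (n₁ n₂ n₃ : ℤ)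
    (hA2f₂ : Hyp.Ruhl1970_A2f (BergmanPlaces.hostFockRecEL n₁ n₂ n₃).toPlaces.d₂)
    (hA2f₃ : Hyp.Ruhl1970_A2f (BergmanPlaces.hostFockRecEL n₁ n₂ n₃).toPlaces.d₃) :
    (BergmanPlaces.hostFockRecEL n₁ n₂ n₃).toPlaces.ArchNonvanishing :=
  (hostFockRecEL_N43_places n₁ n₂ n₃ hA2f₂ hA2f₃).2

/-- THEOREM N4.3 (b) at τ′₁ on the bundle: `Z_{τ′₁}(1/2) = 4`. -/
theorem hostFockRecEL_zetaAt_zero (n₁ n₂ n₃ : ℤ) :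
    (BergmanPlaces.hostFockRecEL n₁ n₂ n₃).toPlaces.zetaAt 0 = 4 :=
  hostFockRec_zetaAt_zero n₁ n₂ n₃ (twistRead n₁) (twistRead n₂) (twistRead n₃) (elLfacTau1 n₁)
    (elLfacTauj n₂) (elLfacTauj n₃)

/-- The values the host inhabitant's `d41.Lv (Sum.inr j)` (t6-p4's doubling-L datum, the M2 carrier's
archimedean factors) must take for the binders `hEL₁A hEL₂A hEL₃A` to be the theorems
`hostFockRecEL_EL₁/₂/₃` on `d43 := (hostFockRecEL n₁ n₂ n₃).toPlaces`. -/
noncomputable def lvArchRead (n₁ n₂ n₃ : ℤ) : Fin 3 → ℂ → ℂ :=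
  ![elLfacTau1 n₁, elLfacTauj n₂, elLfacTauj n₃]

/-- `lvArchRead … 0 = elLfacTau1 n₁`. -/
theorem lvArchRead_zero (n₁ n₂ n₃ : ℤ) : lvArchRead n₁ n₂ n₃ 0 = elLfacTau1 n₁ := rfl

/-- `lvArchRead … 1 = elLfacTauj n₂`. -/
theorem lvArchRead_one (n₁ n₂ n₃ : ℤ) : lvArchRead n₁ n₂ n₃ 1 = elLfacTauj n₂ := rfl

/-- `lvArchRead … 2 = elLfacTauj n₃`. -/
theorem lvArchRead_two (n₁ n₂ n₃ : ℤ) : lvArchRead n₁ n₂ n₃ 2 = elLfacTauj n₃ := rfl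

/-- The three forced archimedean factors do not vanish at `s = 1`. -/
theorem lvArchRead_one_ne_zero (n₁ n₂ n₃ : ℤ) : ∀ j : Fin 3, lvArchRead n₁ n₂ n₃ j 1 ≠ 0 := by
  intro j
  fin_cases j
  · exact elLfacTau1_one_ne_zero n₁
  · exact elLfacTauj_one_ne_zero n₂
  · exact elLfacTauj_one_ne_zero n₃

/-- THEOREM N4.3 on the bundle with the L-factors RE-POINTED at `lvArchRead` (the `withLfac` / NSide form
the M2 carrier consumes, T6N43Lfac / T6N43Contract): the Eischen–Liu binders discharged, the two Rühl
displays the only hypotheses. -/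
theorem hostFockRecEL_N43_places_withLfac (n₁ n₂ n₃ : ℤ)
    (hA2f₂ : Hyp.Ruhl1970_A2f (BergmanPlaces.hostFockRecEL n₁ n₂ n₃).toPlaces.d₂)
    (hA2f₃ : Hyp.Ruhl1970_A2f (BergmanPlaces.hostFockRecEL n₁ n₂ n₃).toPlaces.d₃) :
    (∀ j : Fin 3,
        0 < (((BergmanPlaces.hostFockRecEL n₁ n₂ n₃).toPlaces.withLfac (lvArchRead n₁ n₂ n₃)).zetaAt
          j).re) ∧
      ((BergmanPlaces.hostFockRecEL n₁ n₂ n₃).toPlaces.withLfac (lvArchRead n₁ n₂ n₃)).ArchNonvanishing :=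
  (BergmanPlaces.hostFockRecEL n₁ n₂ n₃).N43_places_bergman_withLfac (lvArchRead n₁ n₂ n₃)
    (eischenLiu_tau1_read n₁) hA2f₂ (eischenLiu_tauj_read n₂) hA2f₃ (eischenLiu_tauj_read n₃)

end N43Host

end Summit.Ventures.HodgeRepro2.T6
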